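import Summits.Ventures.PercRepro.ProfilePointedCircuitClassesTwelveCocircuitA

/-!
# PercRepro — THE COCIRCUIT REGIME, PART B: THE LOCAL LYM OF THE CONTAINMENT RELATION ON `G₀`
(p5, gen 48; `proofs/P5-GM1.md` §71)

Setting of part A: `{a, a'}` a series pair, `{a', e, p}` a cocircuit, `ρ{a, a', e} = 3`; `G₀ := E − {a, a', e, p}`
(8 points), `Q := {a, a', e, p}`.  The DOUBLY CAPTURED demands of (C) are the `W = Y + e + a` with `Y ⊆ G₀` a
3-set such that `Y ∪ Q` has rank `5` («`Q`-tight»); their units are the `S = Y' + a + p` with `Y' ⊆ G₀` a 4-set,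
`Y'` and `G₀ ∖ Y'` independent and `Y' ∪ Q` of rank `6`.  This part proves `#{Y} ≤ #{Y'}` by the LOCAL LYM of the
containment relation `Y ⊂ Y'` (`card_le_card_of_localLym`): every `Y` has at least `2` extensions `Y + z` (a
rank-3 closure holds at most `3` points of the independent 5-set `G₀ ∖ Y`), every `Y'` has at most `3`
sub-demands (four would make `Y'` a set of coloops over `Q` and `ρ(Q) = 2`), and a unit with `3` sub-demands
`Y' − y₁, Y' − y₂, Y' − y₃` gives each of them `≥ 3` extensions (three points of the independent `G₀ ∖ Y'` inside
the closure of `Y' − y_i` would put `y_j` into `cl(G₀ ∖ Y')`, against the independence of `G₀ ∖ (Y' − y_j)`).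
-/

open scoped Matroid

namespace PercRepro.Cogirth

open Finset ThmH Skew Shadow Profile

variable {α : Type} [DecidableEq α] {N : Matroid α} [N.Finite]

section TwelveCocircuitB

/-- `#G₀ = 8` for `G₀ = E − {a, a', e, p}`, four distinct points of a 12-point ground set. -/
theorem card_G₀_eq_eight (hn : (gr N).card = 12) {a a' e p : α} (ha : a ∈ gr N) (ha' : a' ∈ gr N) (he : e ∈ gr N)
    (hp : p ∈ gr N) (hne : a ≠ a') (hea : e ≠ a) (hea' : e ≠ a') (hpa : p ≠ a) (hpa' : p ≠ a') (hep : e ≠ p) :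
    (((((gr N).erase a').erase e).erase p).erase a).card = 8 := by
  rw [card_erase_of_mem, card_erase_of_mem, card_erase_of_mem, card_erase_of_mem ha', hn]
  · exact mem_erase.2 ⟨hea', he⟩
  · exact mem_erase.2 ⟨hep.symm, mem_erase.2 ⟨hpa', hp⟩⟩
  · exact mem_erase.2 ⟨hpa.symm, mem_erase.2 ⟨hea.symm, mem_erase.2 ⟨hne, ha⟩⟩⟩

/-- `G₀ ⊆ H = E − {a', e, p}`. -/
theorem G₀_subset_H {a a' e p : α} :
    ((((gr N).erase a').erase e).erase p).erase a ⊆ (((gr N).erase a').erase e).erase p :=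
  erase_subset _ _

/-- `G₀ ⊆ G = E − {a, a'}`. -/
theorem G₀_subset_G {a a' e p : α} :
    ((((gr N).erase a').erase e).erase p).erase a ⊆ ((gr N).erase a).erase a' := by
  intro x hx
  simp only [mem_erase] at hx ⊢
  exact ⟨hx.2.2.2.1, hx.1, hx.2.2.2.2⟩

/-- `G₀ ⊆ E`. -/
theorem G₀_subset_gr {a a' e p : α} : ((((gr N).erase a').erase e).erase p).erase a ⊆ gr N :=
  (erase_subset _ _).trans ((erase_subset _ _).trans ((erase_subset _ _).trans (erase_subset _ _)))

/-- A subset of `G₀` contains none of `a, a', e, p`. -/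
theorem notMem_of_subset_G₀ {a a' e p : α} {Y : Finset α}
    (hY : Y ⊆ ((((gr N).erase a').erase e).erase p).erase a) : a ∉ Y ∧ a' ∉ Y ∧ e ∉ Y ∧ p ∉ Y := by
  refine ⟨fun h => ?_, fun h => ?_, fun h => ?_, fun h => ?_⟩ <;> have h' := hY h <;> simp only [mem_erase] at h' <;> tauto

/-! ### The two families on `G₀` -/

/-- **EXTENSION OF A DEMAND**: a `Q`-tight independent 3-set `Y ⊆ G₀` with `(G₀ ∖ Y) + a' + p` a basis, extended by a
point `z ∈ G₀ ∖ Y` with `ρ(Y + z) = 4`, is a unit: `Y + z` and `G₀ ∖ (Y + z)` are independent and `(Y + z) ∪ Q` has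
rank `6`. -/
theorem insert_mem_unit_of_mem_demand (hn : (gr N).card = 12) {a a' e p : α} (h : SeriesPair N a a')
    (he : e ∈ gr N) (hp : p ∈ gr N) (hea : e ≠ a) (hea' : e ≠ a') (hpa : p ≠ a) (hpa' : p ≠ a') (hep : e ≠ p)
    (hH : ∀ X ⊆ (((gr N).erase a').erase e).erase p,
      rk N (insert a' X) = rk N X + 1 ∧ rk N (insert e X) = rk N X + 1 ∧ rk N (insert p X) = rk N X + 1)
    {Y : Finset α} (hY : Y ∈ (((((gr N).erase a').erase e).erase p).erase a).powerset.filter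
      (fun Y => Y.card = 3 ∧ rk N Y = 3 ∧
        rk N (insert a' (insert p (((((gr N).erase a').erase e).erase p).erase a \ Y))) = 7 ∧
        rk N (Y ∪ insert a (insert a' (insert e {p}))) = 5))
    {z : α} (hz : z ∈ ((((gr N).erase a').erase e).erase p).erase a \ Y) (hzY : rk N (insert z Y) = 4) :
    insert z Y ∈ (((((gr N).erase a').erase e).erase p).erase a).powerset.filter
      (fun Y' => Y'.card = 4 ∧ rk N Y' = 4 ∧ rk N (((((gr N).erase a').erase e).erase p).erase a \ Y') = 4 ∧
        rk N (Y' ∪ insert a (insert a' (insert e {p}))) = 6) := by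
  have ha : a ∈ gr N := h.1
  have ha' : a' ∈ gr N := h.2.1
  have hne : a ≠ a' := h.2.2.1
  rw [mem_filter, mem_powerset] at hY
  obtain ⟨hYG, hYc, hYr, hYcompl, hYQ⟩ := hY
  rw [mem_sdiff] at hz
  obtain ⟨hzG, hzY'⟩ := hz
  have hzg : z ∈ gr N := G₀_subset_gr hzG
  have hYg : Y ⊆ gr N := hYG.trans G₀_subset_gr
  have hG₀c := card_G₀_eq_eight hn ha ha' he hp hne hea hea' hpa hpa' hep
  have hcompl_c : (((((gr N).erase a').erase e).erase p).erase a \ Y).card = 5 := by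
    rw [card_sdiff_of_subset hYG, hG₀c, hYc]
  have ⟨haG, ha'G, heG, hpG⟩ := notMem_of_subset_G₀ (N := N) (a := a) (a' := a') (e := e) (p := p) (subset_refl _)
  -- the complement `G₀ ∖ Y` is independent: a subset of the basis `(G₀ ∖ Y) + a' + p`
  have hpc : p ∉ ((((gr N).erase a').erase e).erase p).erase a \ Y := fun h' => hpG (mem_sdiff.1 h').1
  have ha'c : a' ∉ insert p (((((gr N).erase a').erase e).erase p).erase a \ Y) := by
    rw [mem_insert, not_or]
    exact ⟨hpa'.symm, fun h' => ha'G (mem_sdiff.1 h').1⟩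
  have hbasis_c : (insert a' (insert p (((((gr N).erase a').erase e).erase p).erase a \ Y))).card = 7 := by
    rw [card_insert_of_notMem ha'c, card_insert_of_notMem hpc, hcompl_c]
  have hcompl_ind : rk N (((((gr N).erase a').erase e).erase p).erase a \ Y) =
      (((((gr N).erase a').erase e).erase p).erase a \ Y).card := by
    apply rk_eq_card_of_subset_of_rk_eq_card ((subset_insert _ _).trans (subset_insert _ _))
    rw [hYcompl, hbasis_c]
  rw [mem_filter, mem_powerset]
  refine ⟨insert_subset hzG hYG, ?_, hzY, ?_, ?_⟩
  · rw [card_insert_of_notMem hzY', hYc]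
  · have heq : ((((gr N).erase a').erase e).erase p).erase a \ insert z Y =
        (((((gr N).erase a').erase e).erase p).erase a \ Y).erase z := by
      ext x
      simp only [mem_sdiff, mem_insert, mem_erase, not_or]
      tauto
    rw [heq, rk_eq_card_of_subset_of_rk_eq_card (erase_subset _ _) hcompl_ind,
      card_erase_of_mem (mem_sdiff.2 ⟨hzG, hzY'⟩), hcompl_c]
  · -- `ρ((Y + z) ∪ Q) = 6`: at most `ρ(Y ∪ Q) + 1`, at least `ρ(Y + z + a + e) = 6`
    have hle : rk N (insert z Y ∪ insert a (insert a' (insert e {p}))) ≤ 6 := by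
      rw [insert_union]
      have := rk_insert_le_add_one hzg (union_subset hYg (insert_subset ha (insert_subset ha'
        (insert_subset he (singleton_subset_iff.2 hp)))))
      omega
    have hge : 6 ≤ rk N (insert z Y ∪ insert a (insert a' (insert e {p}))) := by
      have hzYG : insert z Y ⊆ ((gr N).erase a).erase a' := (insert_subset hzG hYG).trans G₀_subset_G
      have h1 := rk_insert_left_eq_add_one_of_seriesPair h hzYG
      have h2 : insert a (insert z Y) ⊆ (((gr N).erase a').erase e).erase p :=
        insert_subset (mem_erase.2 ⟨hpa.symm, mem_erase.2 ⟨hea.symm, mem_erase.2 ⟨hne, ha⟩⟩⟩)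
          ((insert_subset hzG hYG).trans G₀_subset_H)
      have h3 := (hH _ h2).2.1
      have hsub : insert e (insert a (insert z Y)) ⊆ insert z Y ∪ insert a (insert a' (insert e {p})) := by
        intro x hx
        simp only [mem_insert, mem_union, mem_singleton] at hx ⊢
        tauto
      have := rk_mono' (M := N) hsub
      omega
    omega

/-- **A DEMAND HAS AT LEAST TWO EXTENSIONS**: the points `z ∈ G₀ ∖ Y` with `ρ(Y + z) = 3` lie in the rank-3
closure of `Y` and are independent, so there are at most `3` of them among the `5` points of `G₀ ∖ Y`. -/
theorem two_le_card_filter_rk_insert_eq_four (hn : (gr N).card = 12) {a a' e p : α} (h : SeriesPair N a a')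
    (he : e ∈ gr N) (hp : p ∈ gr N) (hea : e ≠ a) (hea' : e ≠ a') (hpa : p ≠ a) (hpa' : p ≠ a') (hep : e ≠ p)
    {Y : Finset α} (hY : Y ∈ (((((gr N).erase a').erase e).erase p).erase a).powerset.filter
      (fun Y => Y.card = 3 ∧ rk N Y = 3 ∧
        rk N (insert a' (insert p (((((gr N).erase a').erase e).erase p).erase a \ Y))) = 7 ∧
        rk N (Y ∪ insert a (insert a' (insert e {p}))) = 5)) :
    2 ≤ ((((((gr N).erase a').erase e).erase p).erase a \ Y).filter (fun z => rk N (insert z Y) = 4)).card := by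
  have ha : a ∈ gr N := h.1
  have ha' : a' ∈ gr N := h.2.1
  have hne : a ≠ a' := h.2.2.1
  rw [mem_filter, mem_powerset] at hY
  obtain ⟨hYG, hYc, hYr, hYcompl, _⟩ := hY
  have hYg : Y ⊆ gr N := hYG.trans G₀_subset_gr
  have hG₀c := card_G₀_eq_eight hn ha ha' he hp hne hea hea' hpa hpa' hep
  have hcompl_c : (((((gr N).erase a').erase e).erase p).erase a \ Y).card = 5 := by
    rw [card_sdiff_of_subset hYG, hG₀c, hYc]
  have ⟨_, ha'G, _, hpG⟩ := notMem_of_subset_G₀ (N := N) (a := a) (a' := a') (e := e) (p := p) (subset_refl _)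
  have hpc : p ∉ ((((gr N).erase a').erase e).erase p).erase a \ Y := fun h' => hpG (mem_sdiff.1 h').1
  have ha'c : a' ∉ insert p (((((gr N).erase a').erase e).erase p).erase a \ Y) := by
    rw [mem_insert, not_or]
    exact ⟨hpa'.symm, fun h' => ha'G (mem_sdiff.1 h').1⟩
  have hbasis_c : (insert a' (insert p (((((gr N).erase a').erase e).erase p).erase a \ Y))).card = 7 := by
    rw [card_insert_of_notMem ha'c, card_insert_of_notMem hpc, hcompl_c]
  have hcompl_ind : rk N (((((gr N).erase a').erase e).erase p).erase a \ Y) =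
      (((((gr N).erase a').erase e).erase p).erase a \ Y).card := by
    apply rk_eq_card_of_subset_of_rk_eq_card ((subset_insert _ _).trans (subset_insert _ _))
    rw [hYcompl, hbasis_c]
  have hsplit := card_filter_add_card_filter_not
    (s := ((((gr N).erase a').erase e).erase p).erase a \ Y) (fun z => rk N (insert z Y) = 4)
  rw [hcompl_c] at hsplit
  -- the «bad» points lie in `cl(Y)` and are independent: at most `ρ(Y) = 3` of them
  have hbad : ((((((gr N).erase a').erase e).erase p).erase a \ Y).filter
      (fun z => ¬ rk N (insert z Y) = 4)).card ≤ 3 := by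
    rw [← hYr]
    apply card_le_rk_of_subset_clF_of_indep
    · intro z hz
      rw [mem_filter, mem_sdiff] at hz
      obtain ⟨⟨hzG, _⟩, hz4⟩ := hz
      have hzg : z ∈ gr N := G₀_subset_gr hzG
      rw [mem_clF_iff_rk_insert_eq hzg hYg]
      have h1 := rk_insert_le_add_one hzg hYg
      have h2 := rk_mono' (M := N) (subset_insert z Y)
      omega
    · exact rk_eq_card_of_subset_of_rk_eq_card (filter_subset _ _) hcompl_ind
  omega

/-- **A UNIT HAS AT MOST THREE SUB-DEMANDS**: if every `z ∈ Y'` had `Y' − z` `Q`-tight, every point of `Y'` would be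
a coloop over `Q` and `ρ(Y' ∪ Q) = ρ(Q) + 4` would force `ρ(Q) = 2`. -/
theorem card_filter_erase_mem_demand_le_three {a a' e p : α} (h : SeriesPair N a a')
    (he : e ∈ gr N) (hp : p ∈ gr N) (hQ : rk N {a, a', e} = 3)
    {Y' : Finset α} (hY' : Y' ∈ (((((gr N).erase a').erase e).erase p).erase a).powerset.filter
      (fun Y' => Y'.card = 4 ∧ rk N Y' = 4 ∧ rk N (((((gr N).erase a').erase e).erase p).erase a \ Y') = 4 ∧
        rk N (Y' ∪ insert a (insert a' (insert e {p}))) = 6)) :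
    (Y'.filter (fun z => Y'.erase z ∈ (((((gr N).erase a').erase e).erase p).erase a).powerset.filter
      (fun Y => Y.card = 3 ∧ rk N Y = 3 ∧
        rk N (insert a' (insert p (((((gr N).erase a').erase e).erase p).erase a \ Y))) = 7 ∧
        rk N (Y ∪ insert a (insert a' (insert e {p}))) = 5))).card ≤ 3 := by
  have ha : a ∈ gr N := h.1
  have ha' : a' ∈ gr N := h.2.1
  rw [mem_filter, mem_powerset] at hY'
  obtain ⟨hY'G, hY'c, hY'r, _, hY'Q⟩ := hY'
  have hY'g : Y' ⊆ gr N := hY'G.trans G₀_subset_gr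
  have hQg : insert a (insert a' (insert e {p})) ⊆ gr N :=
    insert_subset ha (insert_subset ha' (insert_subset he (singleton_subset_iff.2 hp)))
  by_contra hlt
  have hall : Y'.filter (fun z => Y'.erase z ∈ (((((gr N).erase a').erase e).erase p).erase a).powerset.filter
      (fun Y => Y.card = 3 ∧ rk N Y = 3 ∧
        rk N (insert a' (insert p (((((gr N).erase a').erase e).erase p).erase a \ Y))) = 7 ∧
        rk N (Y ∪ insert a (insert a' (insert e {p}))) = 5)) = Y' := by
    apply eq_of_subset_of_card_le (filter_subset _ _)
    rw [hY'c]
    omega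
  -- every point of `Y'` is a coloop over `Q`
  have hcol : ∀ z ∈ Y', z ∉ clF N (insert a (insert a' (insert e {p})) ∪ Y'.erase z) := by
    intro z hz hcl
    have hz' : z ∈ Y'.filter (fun z => Y'.erase z ∈ (((((gr N).erase a').erase e).erase p).erase a).powerset.filter
      (fun Y => Y.card = 3 ∧ rk N Y = 3 ∧
        rk N (insert a' (insert p (((((gr N).erase a').erase e).erase p).erase a \ Y))) = 7 ∧
        rk N (Y ∪ insert a (insert a' (insert e {p}))) = 5)) := by rw [hall]; exact hz
    rw [mem_filter, mem_filter, mem_powerset] at hz'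
    obtain ⟨_, _, _, _, _, hz5⟩ := hz'
    have hzg : z ∈ gr N := hY'g hz
    have hsub : insert a (insert a' (insert e {p})) ∪ Y'.erase z ⊆ gr N :=
      union_subset hQg ((erase_subset _ _).trans hY'g)
    rw [mem_clF_iff_rk_insert_eq hzg hsub] at hcl
    have heq : insert z (insert a (insert a' (insert e {p})) ∪ Y'.erase z) =
        Y' ∪ insert a (insert a' (insert e {p})) := by
      ext x
      simp only [mem_insert, mem_union, mem_erase, mem_singleton]
      by_cases hx : x = z
      · subst hx
        tauto
      · tauto
    rw [heq, hY'Q, union_comm, hz5] at hcl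
    omega
  have hsum := rk_union_eq_add_card_of_forall_notMem_clF hQg hY'g hcol
  rw [union_comm, hY'Q, hY'c] at hsum
  have := three_le_rk_Q (N := N) (p := p) hQ
  omega

set_option maxHeartbeats 400000 in
/-- **THE LOCAL LYM ON AN EDGE `Y ⊂ Y'`**: the sub-demands of `Y'` are at most the extensions of `Y`.  Only the case
of three sub-demands needs an argument: then `Y = Y' − z₀` for a sub-demand point `z₀`, and if `Y` had `≤ 2`
extensions, three points of the independent 4-set `G₀ ∖ Y'` would lie in the rank-3 closure of `Y`, so every point
of `Y` — in particular a second sub-demand point `y₁` — would lie in `cl(G₀ ∖ Y')`, contradicting the independence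
of `G₀ ∖ (Y' − y₁) = (G₀ ∖ Y') + y₁` required by the sub-demand `Y' − y₁`. -/
theorem card_filter_erase_mem_demand_le_card_filter_rk_insert (hn : (gr N).card = 12) {a a' e p : α}
    (h : SeriesPair N a a') (he : e ∈ gr N) (hp : p ∈ gr N) (hea : e ≠ a) (hea' : e ≠ a') (hpa : p ≠ a)
    (hpa' : p ≠ a') (hep : e ≠ p) (hQ : rk N {a, a', e} = 3)
    {Y : Finset α} (hY : Y ∈ (((((gr N).erase a').erase e).erase p).erase a).powerset.filter
      (fun Y => Y.card = 3 ∧ rk N Y = 3 ∧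
        rk N (insert a' (insert p (((((gr N).erase a').erase e).erase p).erase a \ Y))) = 7 ∧
        rk N (Y ∪ insert a (insert a' (insert e {p}))) = 5))
    {Y' : Finset α} (hY' : Y' ∈ (((((gr N).erase a').erase e).erase p).erase a).powerset.filter
      (fun Y' => Y'.card = 4 ∧ rk N Y' = 4 ∧ rk N (((((gr N).erase a').erase e).erase p).erase a \ Y') = 4 ∧
        rk N (Y' ∪ insert a (insert a' (insert e {p}))) = 6))
    (hYY' : Y ⊆ Y') :
    (Y'.filter (fun z => Y'.erase z ∈ (((((gr N).erase a').erase e).erase p).erase a).powerset.filter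
      (fun Y => Y.card = 3 ∧ rk N Y = 3 ∧
        rk N (insert a' (insert p (((((gr N).erase a').erase e).erase p).erase a \ Y))) = 7 ∧
        rk N (Y ∪ insert a (insert a' (insert e {p}))) = 5))).card ≤
    ((((((gr N).erase a').erase e).erase p).erase a \ Y).filter (fun z => rk N (insert z Y) = 4)).card := by
  have h3 := card_filter_erase_mem_demand_le_three h he hp hQ hY'
  have h2 := two_le_card_filter_rk_insert_eq_four hn h he hp hea hea' hpa hpa' hep hY
  by_cases hc : (Y'.filter (fun z => Y'.erase z ∈ (((((gr N).erase a').erase e).erase p).erase a).powerset.filter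
      (fun Y => Y.card = 3 ∧ rk N Y = 3 ∧
        rk N (insert a' (insert p (((((gr N).erase a').erase e).erase p).erase a \ Y))) = 7 ∧
        rk N (Y ∪ insert a (insert a' (insert e {p}))) = 5))).card ≤ 2
  · omega
  have ha : a ∈ gr N := h.1
  have ha' : a' ∈ gr N := h.2.1
  have hne : a ≠ a' := h.2.2.1
  have hYm := hY
  have hY'm := hY'
  rw [mem_filter, mem_powerset] at hYm hY'm
  obtain ⟨hYG, hYc, hYr, _, _⟩ := hYm
  obtain ⟨hY'G, hY'c, hY'r, hY'compl, _⟩ := hY'm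
  have hYg : Y ⊆ gr N := hYG.trans G₀_subset_gr
  have hY'g : Y' ⊆ gr N := hY'G.trans G₀_subset_gr
  have hG₀c := card_G₀_eq_eight hn ha ha' he hp hne hea hea' hpa hpa' hep
  -- `Y' = Y + z₀`
  have hsd : (Y' \ Y).card = 1 := by rw [card_sdiff_of_subset hYY', hY'c, hYc]
  obtain ⟨z₀, hz₀⟩ := card_eq_one.1 hsd
  have hY'eq : Y' = insert z₀ Y := by
    rw [← union_sdiff_of_subset hYY', hz₀, union_comm, ← insert_eq]
  have hz₀Y : z₀ ∉ Y := fun h' => (mem_sdiff.1 (hz₀ ▸ mem_singleton_self z₀ : z₀ ∈ Y' \ Y)).2 h'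
  have hz₀Y' : z₀ ∈ Y' := (mem_sdiff.1 (hz₀ ▸ mem_singleton_self z₀ : z₀ ∈ Y' \ Y)).1
  have hz₀G : z₀ ∈ ((((gr N).erase a').erase e).erase p).erase a := hY'G hz₀Y'
  -- the «bad» points avoid `z₀`, hence lie in `G₀ ∖ Y'`
  have hbad_sub : (((((gr N).erase a').erase e).erase p).erase a \ Y).filter (fun z => ¬ rk N (insert z Y) = 4) ⊆
      ((((gr N).erase a').erase e).erase p).erase a \ Y' := by
    intro z hz
    rw [mem_filter, mem_sdiff] at hz
    obtain ⟨⟨hzG, hzY⟩, hz4⟩ := hz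
    rw [mem_sdiff, hY'eq, mem_insert, not_or]
    refine ⟨hzG, fun hzz₀ => hz4 ?_, hzY⟩
    rw [hzz₀, ← hY'eq]
    exact hY'r
  by_contra hlt
  have hsplit := card_filter_add_card_filter_not
    (s := ((((gr N).erase a').erase e).erase p).erase a \ Y) (fun z => rk N (insert z Y) = 4)
  have hcompl_c : (((((gr N).erase a').erase e).erase p).erase a \ Y).card = 5 := by
    rw [card_sdiff_of_subset hYG, hG₀c, hYc]
  rw [hcompl_c] at hsplit
  have hbad3 : 3 ≤ ((((((gr N).erase a').erase e).erase p).erase a \ Y).filter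
      (fun z => ¬ rk N (insert z Y) = 4)).card := by omega
  obtain ⟨B₃, hB₃sub, hB₃c⟩ := exists_subset_card_eq hbad3
  have hB₃G : B₃ ⊆ ((((gr N).erase a').erase e).erase p).erase a \ Y' := hB₃sub.trans hbad_sub
  have hB₃g : B₃ ⊆ gr N := hB₃G.trans (sdiff_subset.trans G₀_subset_gr)
  -- `B₃ ⊆ cl(Y)`, `B₃` independent of rank `3`
  have hB₃cl : B₃ ⊆ clF N Y := by
    intro z hz
    have hz' := hB₃sub hz
    rw [mem_filter, mem_sdiff] at hz'
    obtain ⟨⟨hzG, _⟩, hz4⟩ := hz'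
    have hzg : z ∈ gr N := G₀_subset_gr hzG
    rw [mem_clF_iff_rk_insert_eq hzg hYg]
    have h1 := rk_insert_le_add_one hzg hYg
    have h2 := rk_mono' (M := N) (subset_insert z Y)
    omega
  have hcomplY'_c : (((((gr N).erase a').erase e).erase p).erase a \ Y').card = 4 := by
    rw [card_sdiff_of_subset hY'G, hG₀c, hY'c]
  have hB₃r : rk N B₃ = 3 := by
    rw [← hB₃c]
    apply rk_eq_card_of_subset_of_rk_eq_card hB₃G
    rw [hY'compl, hcomplY'_c]
  have hYB₃ : rk N (Y ∪ B₃) = 3 := by rw [rk_union_eq_of_subset_clF hYg hB₃cl, hYr]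
  -- a second sub-demand point `y₁ ≠ z₀`, so `y₁ ∈ Y`
  have hpos : 0 < ((Y'.filter (fun z => Y'.erase z ∈ (((((gr N).erase a').erase e).erase p).erase a).powerset.filter
      (fun Y => Y.card = 3 ∧ rk N Y = 3 ∧
        rk N (insert a' (insert p (((((gr N).erase a').erase e).erase p).erase a \ Y))) = 7 ∧
        rk N (Y ∪ insert a (insert a' (insert e {p}))) = 5))).erase z₀).card := by
    have := card_erase_le (s := Y'.filter (fun z => Y'.erase z ∈
      (((((gr N).erase a').erase e).erase p).erase a).powerset.filter
      (fun Y => Y.card = 3 ∧ rk N Y = 3 ∧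
        rk N (insert a' (insert p (((((gr N).erase a').erase e).erase p).erase a \ Y))) = 7 ∧
        rk N (Y ∪ insert a (insert a' (insert e {p}))) = 5))) (a := z₀)
    have := pred_card_le_card_erase (s := Y'.filter (fun z => Y'.erase z ∈
      (((((gr N).erase a').erase e).erase p).erase a).powerset.filter
      (fun Y => Y.card = 3 ∧ rk N Y = 3 ∧
        rk N (insert a' (insert p (((((gr N).erase a').erase e).erase p).erase a \ Y))) = 7 ∧
        rk N (Y ∪ insert a (insert a' (insert e {p}))) = 5))) (a := z₀)
    omega
  obtain ⟨y₁, hy₁⟩ := card_pos.1 hpos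
  rw [mem_erase, mem_filter, mem_filter, mem_powerset] at hy₁
  obtain ⟨hy₁z₀, hy₁Y', _, _, _, hy₁compl, _⟩ := hy₁
  have hy₁Y : y₁ ∈ Y := by
    rw [hY'eq, mem_insert] at hy₁Y'
    exact hy₁Y'.resolve_left hy₁z₀
  have hy₁g : y₁ ∈ gr N := hYg hy₁Y
  -- `y₁ ∈ cl(B₃) ⊆ cl(G₀ ∖ Y')`
  have hy₁cl : y₁ ∈ clF N B₃ := by
    rw [mem_clF_iff_rk_insert_eq hy₁g hB₃g]
    have h1 := rk_mono' (M := N) (subset_insert y₁ B₃)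
    have h2 : insert y₁ B₃ ⊆ Y ∪ B₃ := insert_subset (mem_union_left _ hy₁Y) subset_union_right
    have h3 := rk_mono' (M := N) h2
    omega
  have hy₁cl' : y₁ ∈ clF N (((((gr N).erase a').erase e).erase p).erase a \ Y') := clF_mono (M := N) hB₃G hy₁cl
  have hcomplY'_g : ((((gr N).erase a').erase e).erase p).erase a \ Y' ⊆ gr N := sdiff_subset.trans G₀_subset_gr
  rw [mem_clF_iff_rk_insert_eq hy₁g hcomplY'_g, hY'compl] at hy₁cl'
  -- but `(G₀ ∖ Y') + y₁ = G₀ ∖ (Y' − y₁)` is independent (a subset of the basis of the sub-demand `Y' − y₁`)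
  have ⟨_, ha'G, _, hpG⟩ := notMem_of_subset_G₀ (N := N) (a := a) (a' := a') (e := e) (p := p) (subset_refl _)
  set G₀ := ((((gr N).erase a').erase e).erase p).erase a with hG₀def
  have hy₁G : y₁ ∈ G₀ := hY'G hy₁Y'
  have heq : insert y₁ (G₀ \ Y') = G₀ \ Y'.erase y₁ := by
    ext x
    simp only [mem_insert, mem_sdiff, mem_erase]
    by_cases hxy : x = y₁
    · subst hxy
      tauto
    · tauto
  have hy₁notY' : y₁ ∉ G₀ \ Y' := fun h' => (mem_sdiff.1 h').2 hy₁Y'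
  have hc5 : (insert y₁ (G₀ \ Y')).card = 5 := by
    rw [card_insert_of_notMem hy₁notY', hcomplY'_c]
  have hind : rk N (insert y₁ (G₀ \ Y')) = 5 := by
    rw [← hc5, heq]
    apply rk_eq_card_of_subset_of_rk_eq_card ((subset_insert _ _).trans (subset_insert _ _))
    rw [hy₁compl, ← heq]
    have hpc : p ∉ insert y₁ (G₀ \ Y') := by
      rw [mem_insert, not_or]
      exact ⟨fun h' => hpG (h' ▸ hy₁G), fun h' => hpG (mem_sdiff.1 h').1⟩
    have ha'c : a' ∉ insert p (insert y₁ (G₀ \ Y')) := by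
      rw [mem_insert, mem_insert, not_or, not_or]
      exact ⟨hpa'.symm, fun h' => ha'G (h' ▸ hy₁G), fun h' => ha'G (mem_sdiff.1 h').1⟩
    rw [card_insert_of_notMem ha'c, card_insert_of_notMem hpc, hc5]
  omega

end TwelveCocircuitB

end PercRepro.Cogirth
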